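import Mathlib
import HarnessLib
import Literature.MathematicalPhysics.QuantumLattice.HubbardGrandCanonicalDensity
import Summits.HubbardSuperconductivity.HubbardSuperconductivity.Theorems.WeakCouplingBCSWcbcsBcsConstructionEnergyDensityLimit

/-!
# Crux `WcbcsBcsConstruction` (stmt-HubbardSuperconductivity-2010), line `ladder-scale-certified-chain`:
# stub (T3) `stub_aeDensityMatching` — almost-sure density matching on the chemical-potential window

Write `n_L(U,μ) = Re ω₀[hubbardTorusWith 2 (L+1) 1 U μ](N)/(L+1)²` for the tracial grand-canonical ground-state
density of the 2D Hubbard torus and `E_L(U,μ)` for its grand-canonical ground-state energy. The registered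
signature `stub_aeDensityMatching`: IF the limit points of `n_L(U,·)` stay in `[11/20, 19/20]` on the window
`μ ∈ [-21/25, -7/20]` for all `U ∈ [0, U₃]` (the conclusion of stub (T2) `stub_densityInsideUnitWindow`, taken as
hypothesis), THEN for the same `U₃` every open sub-interval `(a, b)` of the window contains a chemical potential `μ`
at which `n_L(U,μ) → 1 - δ` for some doping `δ ∈ (0, 1/2)`.

PROOF. (1) The energy density `E_L(U,ν)/(L+1)²` has a thermodynamic limit `e(ν)` for every `ν`
(`Theorems.stub_torusGcEnergyDensityLimit`). (2) `ν ↦ E_L(U,ν)` is non-increasing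
(`groundEnergy_torus_sub_mem_Icc_of_le`), hence so is `e`; a monotone real function is differentiable
Lebesgue-a.e. (`Monotone.ae_differentiableAt`, applied to `-e`). (3) An open interval has positive Lebesgue measure
(`Real.volume_Ioo`), so some `μ ∈ (a, b)` is a differentiability point of `e`. (4) Griffiths' lemma
(`tendsto_gcDensity_of_hasDerivAt`) gives `n_L(U,μ) → -e'(μ)`. (5) The liminf/limsup of a convergent sequence are its
limit, so the hypothesis pins `-e'(μ) ∈ [11/20, 19/20]`; put `δ := 1 + e'(μ) ∈ [1/20, 9/20] ⊂ (0, 1/2)`.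
References: R. B. Griffiths, J. Math. Phys. 5 (1964) 1215; T. Koma, H. Tasaki, J. Stat. Phys. 76 (1994) §1;
Lebesgue's differentiation theorem for monotone functions (folklore).
-/

noncomputable section

-- the tree's namespace `Summit.<Summit>.<Problem>.Theorems` repeats the summit name by design (D-0017)
set_option linter.dupNamespace false

namespace Summit.HubbardSuperconductivity.HubbardSuperconductivity.Theorems

open Literature.MathematicalPhysics.QuantumLattice Literature.Probability.LatticeModels MeasureTheory Matrix Filter
open scoped Topology

/-- Stub (T3) — **almost-sure density matching: every open `μ`-interval of the window contains a density-matched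
chemical potential with doping in `(0, 1/2)`**. Given the brackets of stub (T2) (limit points of the torus density
`n_L(U,μ)` inside `[11/20, 19/20]` for `U ∈ [0, U₃]`, `μ ∈ [-21/25, -7/20]`), for the same `U₃`, every
`U ∈ [0, U₃]` and all `-21/25 ≤ a < b ≤ -7/20` there are `μ ∈ (a, b)` and `δ ∈ (0, 1/2)` with `n_L(U,μ) → 1 - δ`
(thermodynamic limit of the energy density, a.e. differentiability of the antitone limit, an open interval is not
Lebesgue-null, Griffiths' lemma). [cite: KomaTasaki1994, §1] -/
theorem stub_aeDensityMatching :
    (∃ U₃ : ℝ, 0 < U₃ ∧ ∀ U ∈ Set.Icc (0:ℝ) U₃, ∀ μ ∈ Set.Icc (-(21:ℝ) / 25) (-(7:ℝ) / 20),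
      11 / 20 ≤ liminf (fun L : ℕ => ((hubbardTorusWith 2 (L + 1) 1 U μ).groundStateFunctional
        totalNumber).re / ((L + 1 : ℕ) : ℝ) ^ 2) atTop ∧
      limsup (fun L : ℕ => ((hubbardTorusWith 2 (L + 1) 1 U μ).groundStateFunctional
        totalNumber).re / ((L + 1 : ℕ) : ℝ) ^ 2) atTop ≤ 19 / 20) →
    ∃ U₃ : ℝ, 0 < U₃ ∧ ∀ U ∈ Set.Icc (0:ℝ) U₃, ∀ a b : ℝ, -(21:ℝ) / 25 ≤ a → a < b → b ≤ -(7:ℝ) / 20 →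
      ∃ μ ∈ Set.Ioo a b, ∃ δ ∈ Set.Ioo (0:ℝ) (1 / 2),
        Tendsto (fun L : ℕ => ((hubbardTorusWith 2 (L + 1) 1 U μ).groundStateFunctional
          totalNumber).re / ((L + 1 : ℕ) : ℝ) ^ 2) atTop (𝓝 (1 - δ)) := by
  rintro ⟨U₃, hU₃, hB⟩
  refine ⟨U₃, hU₃, fun U hU a b ha hab hb => ?_⟩
  -- (1) thermodynamic limit of the grand-canonical ground-state energy density, for every `ν`
  choose e hlim using fun ν : ℝ => stub_torusGcEnergyDensityLimit U ν
  -- (2) the limit is antitone in the chemical potential, hence differentiable a.e.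
  have hanti : Antitone e := by
    intro ν ν' hνν'
    refine le_of_tendsto_of_tendsto' (hlim ν') (hlim ν) fun L => ?_
    have hV : (0 : ℝ) < ((L + 1 : ℕ) : ℝ) ^ 2 := by positivity
    refine div_le_div_of_nonneg_right ?_ hV.le
    have h0 := (groundEnergy_torus_sub_mem_Icc_of_le (L + 1) 1 U hνν').1
    linarith
  have hae : ∀ᵐ x, DifferentiableAt ℝ e x := by
    filter_upwards [hanti.neg.ae_differentiableAt] with x hx
    exact (differentiableAt_neg_iff (f := e)).1 hx
  -- (3) an open interval is not Lebesgue-null: pick a differentiability point `μ ∈ (a, b)`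
  obtain ⟨μ, hμ, hdiff⟩ : ∃ μ ∈ Set.Ioo a b, DifferentiableAt ℝ e μ := by
    by_contra h
    push Not at h
    have hsub : Set.Ioo a b ⊆ {x | ¬DifferentiableAt ℝ e x} := fun x hx => h x hx
    have h0 : volume (Set.Ioo a b) = 0 := measure_mono_null hsub (ae_iff.1 hae)
    rw [Real.volume_Ioo, ENNReal.ofReal_eq_zero] at h0
    linarith
  -- (4) Griffiths' lemma at `μ`
  have hT := tendsto_gcDensity_of_hasDerivAt 1 U μ (Eventually.of_forall hlim) hdiff.hasDerivAt
  -- (5) the brackets of (T2) pin the limit inside `[11/20, 19/20]`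
  have hμw : μ ∈ Set.Icc (-(21:ℝ) / 25) (-(7:ℝ) / 20) := ⟨by linarith [hμ.1], by linarith [hμ.2]⟩
  obtain ⟨h1, h2⟩ := hB U hU μ hμw
  have h1' : (11 / 20 : ℝ) ≤ -deriv e μ := h1.trans_eq hT.liminf_eq
  have h2' : -deriv e μ ≤ (19 / 20 : ℝ) := hT.limsup_eq.ge.trans h2
  refine ⟨μ, hμ, 1 + deriv e μ, ⟨by linarith, by linarith⟩, ?_⟩
  have hρ : (1 : ℝ) - (1 + deriv e μ) = -deriv e μ := by ring
  rw [hρ]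
  exact hT

end Summit.HubbardSuperconductivity.HubbardSuperconductivity.Theorems

end
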